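import Literature.NumberTheory.DiophantineApproximation.RhinViolaDoubleResidue
import Literature.NumberTheory.DiophantineApproximation.RhinViolaPartialFractions
import Mathlib.Analysis.Calculus.Deriv.Polynomial
import HarnessLib

/-!
# Rhin–Viola 2005, Lemma 2.6 — the integrals `I_z^{(ν)}(0,0,k,l,0)` for `k, l ≥ 1`

Topic `Literature/NumberTheory/DiophantineApproximation`. Everything here is PROVED (no definitions, no named
facts). Source: G. Rhin, C. Viola, *The permutation group method for the dilogarithm*, Ann. Sc. Norm. Super.
Pisa Cl. Sci. (5) 4 (2005) 389–437, Lemma 2.6 (pp. 399–402): the values of `I_z^{(0)}(0,0,k,l,0)` (2.21),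
`I_z^{(1)}(0,0,k,l,0)` (2.22) and `I_z^{(2)}(0,0,k,l,0) = 0`, from which `d_H d_K z^α(z−1)^β I_z(0,0,k,l,0)`
and `… I_z^{(1)}(0,0,k,l,0)` are integer polynomials (done in `RhinViolaLemma26.lean`).

The paper integrates over `x` first ((2.20): `∫₀¹ dx/(x(1−y)+yz)^{k+1} = −(1/(k(1−y)))((1+y(z−1))^{−k} −
(yz)^{−k})`) and, for `I^{(1)}`, replaces the small circle around the moving pole `x/(x−z)` by a fixed contour
and interchanges the integrations. In the tree `I^{(1)}` is defined in residue form
(`RhinViola.innerRes`, a Hasse derivative), so the interchange is replaced by the equivalent exact statement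
that **the residue has an explicit `x`-antiderivative**:

  `d/dx [ (D^{(n−1)}g)(x/(x−z)) / (z−x)^n ] = −n · (D^{(n)}(g·(1−Y)))(x/(x−z)) / (z−x)^{n+1}`

(`hasDerivAt_hasseDeriv_eval_div_pow`; Hasse–Leibniz, `y₀' = −z/(x−z)²`), which with `n = k`,
`g = Y^k(1−Y)^{l−1}` gives `∫₀¹ innerRes dx` in closed form and

  `I_z^{(1)}(0,0,k,l,0) = −z^{−l} (D^{(k−1)}(Y^k(1−Y)^{l−1}))(1/(1−z)) / (k (z−1)^k)`   (≡ (2.22)).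

For `I^{(0)}` we follow (2.20) (Fubini, `x` first) and evaluate `∫₀¹ y^k(1−y)^{l−1}dy/(1+y(z−1))^k` by the
partial fractions of `RhinViolaPartialFractions.lean`, whose `log z`-coefficient is literally
`(D^{(k−1)}(Y^k(1−Y)^{l−1}))(1/(1−z))(z−1)^{−k}`; hence in `I_z = I^{(0)} − (log z) I^{(1)}` the logarithm cancels
identically and `I_z(0,0,k,l,0)` is an explicit rational function of `z` (`I_zero_zero_k_l_zero`).

## References

* G. Rhin, C. Viola, Ann. Sc. Norm. Super. Pisa Cl. Sci. (5) 4 (2005) 389–437, Lemma 2.6, (2.20)–(2.24).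
  [RhinViola2005]
-/

noncomputable section

namespace Literature.NumberTheory.DiophantineApproximation

namespace RhinViola

open _root_.MeasureTheory _root_.Set intervalIntegral Finset Polynomial
open ViolaZudilin (unitSquare denom₁ measurableSet_unitSquare)

/-! ### The `x`-antiderivative of the inner residue -/

/-- `D' ∘ D^{(n−1)} = n·D^{(n)}` (`derivative` after a Hasse derivative). [folklore] -/
theorem derivative_hasseDeriv (g : ℝ[X]) {n : ℕ} (hn : 1 ≤ n) :
    derivative (hasseDeriv (n - 1) g) = (n : ℝ[X]) * hasseDeriv n g := by
  have h := LinearMap.congr_fun (hasseDeriv_comp (R := ℝ) 1 (n - 1)) g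
  simp only [LinearMap.coe_comp, Function.comp_apply, LinearMap.smul_apply, hasseDeriv_one'] at h
  rw [h, show 1 + (n - 1) = n by omega, Nat.choose_one_right, nsmul_eq_mul]

/-- `(D^{(n)}(g·(1−Y)))(y₀) = (1−y₀)(D^{(n)}g)(y₀) − (D^{(n−1)}g)(y₀)` for `n ≥ 1` (Taylor coefficients at `y₀`).
[folklore] -/
theorem hasseDeriv_mul_one_sub_X_eval (g : ℝ[X]) {n : ℕ} (hn : 1 ≤ n) (y₀ : ℝ) :
    (hasseDeriv n (g * (1 - X))).eval y₀ =
      (1 - y₀) * (hasseDeriv n g).eval y₀ - (hasseDeriv (n - 1) g).eval y₀ := by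
  obtain ⟨d, rfl⟩ : ∃ d, n = d + 1 := ⟨n - 1, by omega⟩
  rw [← taylor_coeff, ← taylor_coeff, ← taylor_coeff, taylor_mul, map_sub, taylor_one, taylor_X,
    show (C 1 : ℝ[X]) - (X + C y₀) = C (1 - y₀) - X by rw [C_sub]; ring, mul_sub, coeff_sub,
    mul_comm _ (C (1 - y₀)), coeff_C_mul, Nat.add_sub_cancel, coeff_mul_X]

/-- **The inner residue has an explicit `x`-antiderivative**: for `x ≠ z`, `n ≥ 1` and any polynomial `g`,
`d/dx [ (D^{(n−1)}g)(x/(x−z))/(z−x)^n ] = −n (D^{(n)}(g(1−Y)))(x/(x−z))/(z−x)^{n+1}`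
(the algebraic form of "differentiation in `x` commutes with the residue in `y`").
[cite: RhinViola2005, Lemma 2.6 (proof), (2.23)–(2.24)] -/
theorem hasDerivAt_hasseDeriv_eval_div_pow {z x : ℝ} (hxz : x ≠ z) (g : ℝ[X]) {n : ℕ} (hn : 1 ≤ n) :
    HasDerivAt (fun x => (hasseDeriv (n - 1) g).eval (x / (x - z)) / (z - x) ^ n)
      (-(n : ℝ) * ((hasseDeriv n (g * (1 - X))).eval (x / (x - z)) / (z - x) ^ (n + 1))) x := by
  have hxz' : x - z ≠ 0 := sub_ne_zero.2 hxz
  have hzx : z - x ≠ 0 := sub_ne_zero.2 (Ne.symm hxz)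
  -- `y₀' = −z/(x−z)²`
  have hy : HasDerivAt (fun x : ℝ => x / (x - z)) ((1 * (x - z) - x * 1) / (x - z) ^ 2) x :=
    (hasDerivAt_id x).div ((hasDerivAt_id x).sub_const z) hxz'
  -- the polynomial part, by the chain rule
  have hP := ((hasseDeriv (n - 1) g).hasDerivAt (x / (x - z))).comp x hy
  rw [derivative_hasseDeriv g hn, eval_mul, eval_natCast] at hP
  -- the denominator
  have hden : HasDerivAt (fun x : ℝ => (z - x) ^ n) ((n : ℝ) * (z - x) ^ (n - 1) * -1) x := by
    refine ((hasDerivAt_pow n (z - x)).comp x ((hasDerivAt_id x).const_sub z)).congr_deriv ?_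
    simp
  have hdiv := hP.div hden (pow_ne_zero _ hzx)
  refine hdiv.congr_deriv ?_
  rw [hasseDeriv_mul_one_sub_X_eval g hn]
  obtain ⟨d, rfl⟩ : ∃ d, n = d + 1 := ⟨n - 1, by omega⟩
  simp only [Nat.add_sub_cancel, Function.comp_apply, pow_succ]
  push_cast
  field_simp
  ring

/-- **`∫₀¹ innerRes z 0 k l 0 dx` in closed form** (`z > 1`, `k, l ≥ 1`):
`= −(D^{(k−1)}(Y^k(1−Y)^{l−1}))(1/(1−z)) / (k (z−1)^k)` (the boundary term at `x = 0` vanishes since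
`Y^k(1−Y)^{l−1}` has no terms of degree `< k`). [cite: RhinViola2005, (2.22)] -/
theorem integral_innerRes_zero_k_l_zero {z : ℝ} (hz : 1 < z) {k l : ℕ} (hk : 1 ≤ k) (hl : 1 ≤ l) :
    ∫ x in (0 : ℝ)..1, innerRes z 0 k l 0 x =
      -((hasseDeriv (k - 1) ((X : ℝ[X]) ^ k * (1 - X) ^ (l - 1))).eval (1 / (1 - z)) / (k * (z - 1) ^ k)) := by
  set g : ℝ[X] := X ^ k * (1 - X) ^ (l - 1) with hg
  have hk0 : (k : ℝ) ≠ 0 := by exact_mod_cast (by omega : k ≠ 0)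
  have hgX : g * (1 - X) = X ^ k * (1 - X) ^ l := by
    rw [hg, mul_assoc, ← pow_succ, Nat.sub_add_cancel hl]
  -- the integrand is `−(1/k)` times the derivative of `F`
  set F : ℝ → ℝ := fun x => (hasseDeriv (k - 1) g).eval (x / (x - z)) / (z - x) ^ k with hF
  have hderiv : ∀ x ∈ uIcc (0 : ℝ) 1, HasDerivAt F (-(k : ℝ) * innerRes z 0 k l 0 x) x := by
    intro x hx
    rw [Set.uIcc_of_le zero_le_one] at hx
    have hxz : x ≠ z := by intro h; linarith [hx.2]
    have h := hasDerivAt_hasseDeriv_eval_div_pow hxz g hk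
    rw [hgX] at h
    refine h.congr_deriv ?_
    rw [innerRes, if_pos (by omega)]
    simp
  have hint : IntervalIntegrable (fun x => -(k : ℝ) * innerRes z 0 k l 0 x) volume 0 1 := by
    refine (continuousOn_const.mul ?_).intervalIntegrable
    rw [Set.uIcc_of_le zero_le_one]
    exact continuousOn_innerRes hz 0 k l 0
  have hftc := integral_eq_sub_of_hasDerivAt hderiv hint
  rw [intervalIntegral.integral_const_mul] at hftc
  -- the boundary values
  have hF0 : F 0 = 0 := by
    simp only [hF, zero_div, sub_zero]
    rw [← coeff_zero_eq_eval_zero, hasseDeriv_coeff, zero_add, hg, coeff_X_pow_mul', if_neg (by omega)]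
    simp
  have hF1 : F 1 = (hasseDeriv (k - 1) g).eval (1 / (1 - z)) / (z - 1) ^ k := by
    simp only [hF, one_div]
  rw [hF0, hF1, sub_zero] at hftc
  calc ∫ x in (0 : ℝ)..1, innerRes z 0 k l 0 x
      = (-(k : ℝ))⁻¹ * (-(k : ℝ) * ∫ x in (0 : ℝ)..1, innerRes z 0 k l 0 x) := by field_simp
    _ = (-(k : ℝ))⁻¹ * ((hasseDeriv (k - 1) g).eval (1 / (1 - z)) / (z - 1) ^ k) := by rw [hftc]
    _ = _ := by ring

/-- **RV (2.22) in residue form**: for `z > 1`, `k, l ≥ 1`,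
`I_z^{(1)}(0,0,k,l,0) = −z^{−l} (D^{(k−1)}(Y^k(1−Y)^{l−1}))(1/(1−z)) / (k (z−1)^k)`.
[cite: RhinViola2005, (2.22)] -/
theorem I1_zero_zero_k_l_zero {z : ℝ} (hz : 1 < z) {k l : ℕ} (hk : 1 ≤ k) (hl : 1 ≤ l) :
    I1 z 0 0 k l 0 = z ^ (-(l : ℤ)) *
      -((hasseDeriv (k - 1) ((X : ℝ[X]) ^ k * (1 - X) ^ (l - 1))).eval (1 / (1 - z)) / (k * (z - 1) ^ k)) := by
  rw [I1, ← integral_innerRes_zero_k_l_zero hz hk hl]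
  simp

/-- `I_z^{(2)}(0,0,k,l,0) = 0` for `k ≥ 1` (here `D^{(i+k)} 1 = 0`).
[cite: RhinViola2005, Lemma 2.6 (proof), (2.24)] -/
theorem I2_zero_zero_k_l_zero (z : ℝ) {k : ℕ} (hk : 1 ≤ k) (l : ℕ) : I2 z 0 0 k l 0 = 0 := by
  rw [I2, if_pos (by omega)]
  refine mul_eq_zero_of_right _ (mul_eq_zero_of_right _ (sum_eq_zero fun i _ => ?_))
  have h1 : (X : ℝ[X]) ^ 0 * (1 - X) ^ 0 = 1 := by simp
  have h2 : hasseDeriv (i + (0 + k - 0)) (1 : ℝ[X]) = 0 := hasseDeriv_apply_one _ (by omega)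
  rw [h1, h2, eval_zero, mul_zero]

/-! ### `I_z^{(0)}(0,0,k,l,0)`: integration over `x` first (RV (2.20)) -/

/-- **RV (2.20)**: for `0 < y < 1`, `z ≥ 1`, `k ≥ 1`,
`∫₀¹ dx/(x(1−y)+yz)^{k+1} = (1/(k(1−y)))·((yz)^{−k} − (1−y+yz)^{−k})`. [cite: RhinViola2005, (2.20)] -/
theorem integral_inv_denom_pow {z y : ℝ} (hz : 1 ≤ z) (hy : y ∈ Ioo (0 : ℝ) 1) {k : ℕ} (hk : 1 ≤ k) :
    ∫ x in (0 : ℝ)..1, 1 / (x * (1 - y) + y * z) ^ (k + 1) =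
      1 / (k * (1 - y)) * (1 / (y * z) ^ k - 1 / (1 - y + y * z) ^ k) := by
  have hy1 : 1 - y ≠ 0 := by linarith [hy.2]
  have hk0 : (k : ℝ) ≠ 0 := by exact_mod_cast (by omega : k ≠ 0)
  have hpos : ∀ x ∈ uIcc (0 : ℝ) 1, 0 < x * (1 - y) + y * z := by
    intro x hx
    rw [Set.uIcc_of_le zero_le_one] at hx
    nlinarith [hx.1, hy.1, hy.2, mul_pos hy.1 (zero_lt_one.trans_le hz)]
  have hderiv : ∀ x ∈ uIcc (0 : ℝ) 1,
      HasDerivAt (fun x : ℝ => -(1 / (k * (1 - y))) * ((x * (1 - y) + y * z) ^ k)⁻¹)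
      (1 / (x * (1 - y) + y * z) ^ (k + 1)) x := by
    intro x hx
    have hD := (hpos x hx).ne'
    have h1 : HasDerivAt (fun x : ℝ => (x * (1 - y) + y * z) ^ k)
        ((k : ℝ) * (x * (1 - y) + y * z) ^ (k - 1) * (1 - y)) x := by
      refine ((hasDerivAt_pow k _).comp x
        (((hasDerivAt_id x).mul_const (1 - y)).add_const (y * z))).congr_deriv ?_
      simp
    have h2 := (h1.inv (pow_ne_zero _ hD)).const_mul (-(1 / (k * (1 - y))))
    have key : ∀ D : ℝ, D ≠ 0 →
        -(1 / ((k : ℝ) * (1 - y))) * (-((k : ℝ) * D ^ (k - 1) * (1 - y)) / (D ^ k) ^ 2) = 1 / D ^ (k + 1) := by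
      intro D hD0
      obtain ⟨k', rfl⟩ : ∃ k', k = k' + 1 := ⟨k - 1, by omega⟩
      rw [Nat.add_sub_cancel]
      field_simp
      ring
    exact h2.congr_deriv (key _ hD)
  have hcont : ContinuousOn (fun x : ℝ => 1 / (x * (1 - y) + y * z) ^ (k + 1)) (uIcc (0 : ℝ) 1) :=
    continuousOn_const.div (by fun_prop) fun x hx => pow_ne_zero _ (hpos x hx).ne'
  rw [integral_eq_sub_of_hasDerivAt hderiv hcont.intervalIntegrable]
  have hyz : y * z ≠ 0 := (mul_pos hy.1 (zero_lt_one.trans_le hz)).ne'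
  have h1yz : 1 - y + y * z ≠ 0 := by nlinarith [hy.1, hy.2, mul_pos hy.1 (zero_lt_one.trans_le hz)]
  simp only [one_mul, zero_mul, zero_add]
  field_simp
  ring

/-- `natDegree (X^a (1−X)^b) ≤ a + b` over `ℝ`. [folklore] -/
theorem natDegree_X_pow_mul_one_sub_X_pow_le' (a b : ℕ) : ((X : ℝ[X]) ^ a * (1 - X) ^ b).natDegree ≤ a + b := by
  have h1 : ((X : ℝ[X]) ^ a).natDegree ≤ a := (natDegree_X_pow a).le
  have h2 : ((1 - X : ℝ[X]) ^ b).natDegree ≤ b := by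
    have := natDegree_pow_le_of_le b
      (show (1 - X : ℝ[X]).natDegree ≤ 1 from (natDegree_sub_le _ _).trans (by simp))
    simpa using this
  exact natDegree_mul_le.trans (add_le_add h1 h2)

/-- The `x`-section of the real integrand at `(0,0,k,l,0)` (`k, l ≥ 1`, `0 < y < 1`, `z ≥ 1`):
`∫₀¹ y^k(1−y)^l dx/(x(1−y)+yz)^{k+1} = (1/k)·((1−y)^{l−1} z^{−k} − y^k(1−y)^{l−1}/(1+y(z−1))^k)`.
[cite: RhinViola2005, (2.20)–(2.21)] -/
theorem integral_integrand_zero_zero_k_l_zero_section {z y : ℝ} (hz : 1 ≤ z) (hy : y ∈ Ioo (0 : ℝ) 1)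
    {k l : ℕ} (hk : 1 ≤ k) (hl : 1 ≤ l) :
    ∫ x in Icc (0 : ℝ) 1, integrand z 0 0 k l 0 (x, y) =
      1 / k * ((1 - y) ^ (l - 1) * (1 / z ^ k) -
        ((X : ℝ[X]) ^ k * (1 - X) ^ (l - 1)).eval y / (1 + y * (z - 1)) ^ k) := by
  have hy0 : y ≠ 0 := hy.1.ne'
  have hy1 : 1 - y ≠ 0 := by linarith [hy.2]
  have hk0 : (k : ℝ) ≠ 0 := by exact_mod_cast (by omega : k ≠ 0)
  have hz0 : z ≠ 0 := by linarith
  have hint : ∀ x : ℝ, integrand z 0 0 k l 0 (x, y) =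
      y ^ k * (1 - y) ^ l * (1 / (x * (1 - y) + y * z) ^ (k + 1)) := by
    intro x
    simp only [integrand, denom₁, pow_zero, one_mul, mul_one, Nat.zero_add]
    ring
  simp_rw [hint]
  rw [integral_Icc_eq_integral_Ioc, ← integral_of_le zero_le_one, intervalIntegral.integral_const_mul,
    integral_inv_denom_pow hz hy hk]
  obtain ⟨l', rfl⟩ : ∃ l', l = l' + 1 := ⟨l - 1, by omega⟩
  simp only [Nat.add_sub_cancel, eval_mul, eval_pow, eval_X, eval_sub, eval_one]
  have h1yz : 1 - y + y * z ≠ 0 := by nlinarith [hy.1, hy.2, mul_pos hy.1 (zero_lt_one.trans_le hz)]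
  rw [show 1 + y * (z - 1) = 1 - y + y * z by ring]
  field_simp
  ring

/-- **RV (2.21), in partial-fraction form**: for `z > 1`, `k, l ≥ 1`, with `g = Y^k(1−Y)^{l−1}`, `y₁ = 1/(1−z)`,
`I_z^{(0)}(0,0,k,l,0) = (z^{−l}/k)·( z^{−k}/l − Σ_{i<k+l, i≠k−1} (D^{(i)}g)(y₁)(z^{i−k+1} − 1)(z−1)^{−(i+1)}/(i−k+1)`
`  − (D^{(k−1)}g)(y₁)(z−1)^{−k} log z )`. [cite: RhinViola2005, (2.21)] -/
theorem I0_zero_zero_k_l_zero {z : ℝ} (hz : 1 < z) {k l : ℕ} (hk : 1 ≤ k) (hl : 1 ≤ l) :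
    I0 z 0 0 k l 0 = z ^ (-(l : ℤ)) * (1 / k * (1 / z ^ k * (1 / l) -
      ((∑ i ∈ (range (k + l)).erase (k - 1),
          (hasseDeriv i ((X : ℝ[X]) ^ k * (1 - X) ^ (l - 1))).eval (1 / (1 - z)) *
            ((z ^ ((i : ℤ) - k + 1) - 1) * (z - 1) ^ (-((i : ℤ) + 1)) / ((i : ℝ) - k + 1))) +
        (hasseDeriv (k - 1) ((X : ℝ[X]) ^ k * (1 - X) ^ (l - 1))).eval (1 / (1 - z)) *
          ((z - 1) ^ (-(k : ℤ)) * Real.log z)))) := by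
  set g : ℝ[X] := X ^ k * (1 - X) ^ (l - 1) with hg
  -- Fubini, `x` first
  have hint : Integrable (integrand z 0 0 k l 0)
      (((volume : Measure ℝ).restrict (Icc 0 1)).prod ((volume : Measure ℝ).restrict (Icc 0 1))) := by
    have hi := integrableOn_integrand hz.le 0 0 k l 0
    rwa [IntegrableOn, ViolaZudilin.volume_restrict_unitSquare] at hi
  have hF : ∫ p in unitSquare, integrand z 0 0 k l 0 p =
      ∫ y in Icc (0 : ℝ) 1, ∫ x in Icc (0 : ℝ) 1, integrand z 0 0 k l 0 (x, y) := by
    rw [show (∫ p in unitSquare, integrand z 0 0 k l 0 p) = ∫ p, integrand z 0 0 k l 0 p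
        ∂((volume : Measure ℝ).restrict (Icc 0 1)).prod ((volume : Measure ℝ).restrict (Icc 0 1)) by
      rw [← ViolaZudilin.volume_restrict_unitSquare]]
    exact integral_prod_symm _ hint
  have hinner : EqOn (fun y : ℝ => ∫ x in Icc (0 : ℝ) 1, integrand z 0 0 k l 0 (x, y))
      (fun y => 1 / k * ((1 - y) ^ (l - 1) * (1 / z ^ k)) - 1 / k * (g.eval y / (1 + y * (z - 1)) ^ k))
      (Ioo (0 : ℝ) 1) := by
    intro y hy
    simp only
    rw [integral_integrand_zero_zero_k_l_zero_section hz.le hy hk hl, hg]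
    ring
  -- the two outer pieces
  have hden : ∀ y ∈ Icc (0 : ℝ) 1, (1 + y * (z - 1)) ^ k ≠ 0 := fun y hy =>
    pow_ne_zero _ (by nlinarith [hy.1, hz] : (0 : ℝ) < 1 + y * (z - 1)).ne'
  have hc1 : Continuous fun y : ℝ => 1 / (k : ℝ) * ((1 - y) ^ (l - 1) * (1 / z ^ k)) := by fun_prop
  have hc2 : ContinuousOn (fun y : ℝ => 1 / (k : ℝ) * (g.eval y / (1 + y * (z - 1)) ^ k)) (Icc (0 : ℝ) 1) :=
    continuousOn_const.mul ((Polynomial.continuous _).continuousOn.div (by fun_prop) hden)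
  have h1 : IntegrableOn (fun y : ℝ => 1 / (k : ℝ) * ((1 - y) ^ (l - 1) * (1 / z ^ k))) (Ioo (0 : ℝ) 1) :=
    (hc1.continuousOn.integrableOn_Icc).mono_set Ioo_subset_Icc_self
  have h2 : IntegrableOn (fun y : ℝ => 1 / (k : ℝ) * (g.eval y / (1 + y * (z - 1)) ^ k)) (Ioo (0 : ℝ) 1) :=
    hc2.integrableOn_Icc.mono_set Ioo_subset_Icc_self
  -- the elementary `y`-integrals
  have hI1 : ∫ y in (0 : ℝ)..1, (1 - y) ^ (l - 1) = 1 / l := by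
    rw [intervalIntegral.integral_comp_sub_left (fun u : ℝ => u ^ (l - 1)) 1, integral_pow]
    obtain ⟨l', rfl⟩ : ∃ l', l = l' + 1 := ⟨l - 1, by omega⟩
    simp
  have hW := integral_eval_div_pow_eq hz g hk
    (lt_of_le_of_lt (natDegree_X_pow_mul_one_sub_X_pow_le' k (l - 1)) (by omega)) (by omega : k ≤ k + l)
  rw [I0, hF, integral_Icc_eq_integral_Ioo, setIntegral_congr_fun measurableSet_Ioo hinner,
    integral_sub h1 h2, MeasureTheory.integral_const_mul, MeasureTheory.integral_const_mul,
    ← integral_Ioc_eq_integral_Ioo, ← integral_of_le zero_le_one,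
    ← integral_Ioc_eq_integral_Ioo, ← integral_of_le zero_le_one,
    intervalIntegral.integral_mul_const, hI1, hW]
  set S := ∑ i ∈ (range (k + l)).erase (k - 1), (hasseDeriv i g).eval (1 / (1 - z)) *
    ((z ^ ((i : ℤ) - k + 1) - 1) * (z - 1) ^ (-((i : ℤ) + 1)) / ((i : ℝ) - k + 1)) with hS
  simp only [Nat.cast_zero]
  ring

/-- **Rhin–Viola 2005, Lemma 2.6 — `I_z(0,0,k,l,0)` is log-free and explicit**: for `z > 1`, `k, l ≥ 1`,
with `g = Y^k(1−Y)^{l−1}`, `y₁ = 1/(1−z)`,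
`I_z(0,0,k,l,0) = (z^{−l}/k)·( z^{−k}/l − Σ_{i<k+l, i≠k−1} (D^{(i)}g)(y₁)(z^{i−k+1} − 1)(z−1)^{−(i+1)}/(i−k+1) )`.
[cite: RhinViola2005, Lemma 2.6, (2.21)–(2.22)] -/
theorem I_zero_zero_k_l_zero {z : ℝ} (hz : 1 < z) {k l : ℕ} (hk : 1 ≤ k) (hl : 1 ≤ l) :
    I z 0 0 k l 0 = z ^ (-(l : ℤ)) * (1 / k * (1 / z ^ k * (1 / l) -
      ∑ i ∈ (range (k + l)).erase (k - 1),
        (hasseDeriv i ((X : ℝ[X]) ^ k * (1 - X) ^ (l - 1))).eval (1 / (1 - z)) *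
          ((z ^ ((i : ℤ) - k + 1) - 1) * (z - 1) ^ (-((i : ℤ) + 1)) / ((i : ℝ) - k + 1)))) := by
  have hk0 : (k : ℝ) ≠ 0 := by exact_mod_cast (by omega : k ≠ 0)
  have hz1 : (z - 1) ^ k ≠ 0 := pow_ne_zero _ (by linarith)
  rw [I, I0_zero_zero_k_l_zero hz hk hl, I1_zero_zero_k_l_zero hz hk hl, zpow_neg (z - 1), zpow_natCast]
  field_simp
  ring

end RhinViola

end Literature.NumberTheory.DiophantineApproximation

end
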